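import Mathlib
import HarnessLib
import Summits.HubbardSuperconductivity.HubbardSuperconductivity.Theorems.ComplexGFFStiffnessHypALocalTwoPointSlotConversion

/-!
# Crux `HypALocalTwoPoint`, line `gnv` — the LAST-SCALE `q`-slots (F4Φ2), (F4Φ22) of the [ABKM19] package
# composed with the tuning map `q = hamTuningMap ρ` (census F1 residual; continuation of `…SlotConversion`)

Route `route-HubbardSuperconductivity-ComplexGFFStiffness`, crux item stmt-HubbardSuperconductivity-19155
(`HypALocalTwoPoint`), registered stub `stub_twoPointGivenZ` (⇐ `FreeEnergyBounds` ⇐ route children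
`F4Statement 4`, `H1bcStatement 4`, `F1Residual`).  The last-scale functional `Φ_q(y) = ∫ y(Λ_N) dμ_{𝒞_{1+q,N+1}}`
(`PackageAt.lastScale`) is LINEAR in the activity `y` (integrability of admissible `N`-activities under the last
step measure: `StepKernelBounds` at scale `N + 1`, `TunedFlowLastScale.integrable_last_of_mem_activitySpace`), so the
slot (F4Φ2) — Lipschitz in `q` for activities in the ball `‖y‖_N ≤ r` — rescales to EVERY activity when `r > 0`,
and gives both `hΦ2` and the mixed hypothesis `hΦ12` of `exists_freeEnergy_of_package`; (F4Φ22) gives `hΦ22` on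
parallelograms of seeds (the tuning map is real-linear on the `ρ`-ball):

* `lastScale_smul`, `lastScale_sub` — homogeneity / additivity of `Φ_q` in the activity;
* `norm_lastScale_sub_le_of_F4Φ2` — (F4Φ2) without the radius restriction (`r > 0`);
* `lastScale_sub_le_of_F4Φ2` (`hΦ2`), `lastScale_sub_sub_le_of_F4Φ2` (`hΦ12`), `lastScale_secondDiff_le_of_F4Φ22` (`hΦ22`).

All proved, no `sorry`, no new definition; general `d`.  Honest scope: plumbing for a rung route (stiffness of a
complex Gaussian gradient field); nothing about superconductivity in the Hubbard model.

## References
* S. Adams, S. Buchholz, R. Kotecký, S. Müller, arXiv:1910.13564, Lemma 8.4 (last scale), Lemma 12.6,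
  Ch. 4.4 (4.12) [AdamsBuchholzKoteckyMuller2019].
-/

noncomputable section

-- `Summit.<Summit>.<Problem>`: single-conjunct summit, the duplicate component is mandated (D-0017).
set_option linter.dupNamespace false

namespace Summit.HubbardSuperconductivity.HubbardSuperconductivity.Theorems.ComplexGFF

open scoped BigOperators
open Real Finset MeasureTheory
open Literature.MathematicalPhysics.StatisticalMechanics.GradientRG
open Literature.MathematicalPhysics.QuantumFieldTheory
open Literature.Dynamics.Hyperbolic

variable {d : ℕ} (P : PackageData d) [Fact (0 < P.h)] [Fact (0 < P.L)] {N M : ℕ} [NeZero M]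
  (Q : PackageAt P N M)

/-! ## The last-scale functional: linearity in the activity, and the slots (F4Φ2), (F4Φ22) ⟹ `hΦ2`, `hΦ12`, `hΦ22` -/

omit [Fact (0 < P.h)] [Fact (0 < P.L)] in
/-- Homogeneity of the last-scale functional in the activity: `Φ_q(t·y) = t·Φ_q(y)`. -/
theorem lastScale_smul (q : Matrix (Fin d) (Fin d) ℝ) (t : ℝ) (y : activitySpace Q.normParams N) :
    Q.lastScale q (t • y) = t • Q.lastScale q y := by
  show ∫ φ, ((t • y : activitySpace Q.normParams N) :
      Finset (Fin d → ZMod M) → ((Fin d → ZMod M) → ℝ) → ℂ) Finset.univ φ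
        ∂(stepMeasure (Q.𝒞 ((1 : Matrix (Fin d) (Fin d) ℝ) + q) (N + 1))) =
    t • ∫ φ, ((y : activitySpace Q.normParams N) :
      Finset (Fin d → ZMod M) → ((Fin d → ZMod M) → ℝ) → ℂ) Finset.univ φ
        ∂(stepMeasure (Q.𝒞 ((1 : Matrix (Fin d) (Fin d) ℝ) + q) (N + 1)))
  rw [← integral_smul]
  rfl

omit [Fact (0 < P.h)] [Fact (0 < P.L)] in
/-- Additivity of the last-scale functional in the activity at a tuning parameter of the ball (the
activities are integrable by `StepKernelBounds` at the last scale): `Φ_q(y − y') = Φ_q(y) − Φ_q(y')`. -/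
theorem lastScale_sub {q : Matrix (Fin d) (Fin d) ℝ} (hq : P.InBall q) (y y' : activitySpace Q.normParams N) :
    Q.lastScale q (y - y') = Q.lastScale q y - Q.lastScale q y' := by
  have hA : 0 < P.A := by linarith [P.hA1]
  have hSN := stepKernelBounds_one_add_of_torusFRD P.hd P.hMord P.hMR P.hLodd P.hL P.hθbar P.hlam P.hn P.hn2
    P.hnñ P.hc P.hC1 Q.hallA Q.hB (k := N) le_rfl P.hθ0 P.hθ P.hT₀ P.hKT₀ hq.1 hq.2
  have hi := integrable_last_of_mem_activitySpace (p := P.pT) (r₀ := P.r₀) (𝒞s := Q.kernels q)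
    P.hLodd Q.hM Q.hB hSN hA y
  have hi' := integrable_last_of_mem_activitySpace (p := P.pT) (r₀ := P.r₀) (𝒞s := Q.kernels q)
    P.hLodd Q.hM Q.hB hSN hA y'
  show ∫ φ, ((y - y' : activitySpace Q.normParams N) :
      Finset (Fin d → ZMod M) → ((Fin d → ZMod M) → ℝ) → ℂ) Finset.univ φ
        ∂(stepMeasure (Q.𝒞 ((1 : Matrix (Fin d) (Fin d) ℝ) + q) (N + 1))) =
    (∫ φ, ((y : activitySpace Q.normParams N) :
      Finset (Fin d → ZMod M) → ((Fin d → ZMod M) → ℝ) → ℂ) Finset.univ φ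
        ∂(stepMeasure (Q.𝒞 ((1 : Matrix (Fin d) (Fin d) ℝ) + q) (N + 1)))) -
    ∫ φ, ((y' : activitySpace Q.normParams N) :
      Finset (Fin d → ZMod M) → ((Fin d → ZMod M) → ℝ) → ℂ) Finset.univ φ
        ∂(stepMeasure (Q.𝒞 ((1 : Matrix (Fin d) (Fin d) ℝ) + q) (N + 1)))
  rw [← integral_sub hi hi']
  rfl

omit [Fact (0 < P.h)] [Fact (0 < P.L)] in
/-- **The slot (F4Φ2) WITHOUT the radius restriction** (the functional is linear in the activity, so the
Lipschitz bound on the ball `c ≤ r`, `r > 0`, rescales to every activity):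
`‖Φ_q(y) − Φ_q'(y)‖ ≤ φ_T Σ|q − q'| c` whenever `‖y‖_N ≤ c`. -/
theorem norm_lastScale_sub_le_of_F4Φ2 {φT : ℝ} (hr : 0 < P.r) (hF : F4Φ2 P Q φT)
    {q q' : Matrix (Fin d) (Fin d) ℝ} (hq : P.InBall q) (hq' : P.InBall q')
    (y : activitySpace Q.normParams N) {c : ℝ} (hy : activityNormLE Q.normParams N y c) :
    ‖Q.lastScale q y - Q.lastScale q' y‖ ≤ φT * esum (q - q') * c := by
  by_cases hcr : c ≤ P.r
  · exact hF q q' hq hq' y c hy hcr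
  · rw [not_le] at hcr
    have hc : 0 < c := hr.trans hcr
    set t : ℝ := P.r / c with ht
    have ht0 : 0 < t := div_pos hr hc
    have hty : activityNormLE Q.normParams N (t • y) (|t| * c) :=
      WeakNormLE.smul hy (activitySpace.contDiff y) t
    have htc : |t| * c = P.r := by rw [abs_of_pos ht0, ht]; field_simp
    have h1 := hF q q' hq hq' (t • y) (|t| * c) hty htc.le
    rw [lastScale_smul, lastScale_smul, ← smul_sub, norm_smul, Real.norm_eq_abs, abs_of_pos ht0] at h1
    have h2 : t * ‖Q.lastScale q y - Q.lastScale q' y‖ ≤ t * (φT * esum (q - q') * c) := by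
      calc _ ≤ φT * esum (q - q') * (t * c) := h1
        _ = t * (φT * esum (q - q') * c) := by ring
    exact le_of_mul_le_mul_left h2 ht0

/-- **(F4Φ2) ⟹ `hΦ2`**: `‖Φ(h₀, y) − Φ(h₀', y)‖ ≤ (φ_T c_q)‖h₀ − h₀'‖·c` on the `ρ`-ball. -/
theorem lastScale_sub_le_of_F4Φ2 {φT ρ : ℝ} (hφT : 0 ≤ φT) (hρ : 0 ≤ ρ)
    (hqT₀ : 2 * (d : ℝ) ^ 2 / (((P.L ^ (d * 0) : ℕ) : ℝ) * (fieldWt P.h (P.L : ℝ) d 0 / (P.L : ℝ) ^ 0) ^ 2) * ρ ≤ P.T₀) (hF : F4Φ2 P Q φT) :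
    ∀ h₀ h₀' : HamSpace ℂ d (fieldWt P.h (P.L : ℝ) d 0) ((P.L : ℝ) ^ 0) (P.L ^ (d * 0)), ‖h₀‖ ≤ ρ → ‖h₀'‖ ≤ ρ →
      ∀ (yN : activitySpace Q.normParams N) (cv : ℝ), activityNormLE Q.normParams N yN cv → cv ≤ P.r →
        ‖Q.lastScale (hamTuningMap ρ h₀) yN - Q.lastScale (hamTuningMap ρ h₀') yN‖ ≤
          φT * (2 * (d : ℝ) ^ 2 / (((P.L ^ (d * 0) : ℕ) : ℝ) * (fieldWt P.h (P.L : ℝ) d 0 / (P.L : ℝ) ^ 0) ^ 2)) * ‖h₀ - h₀'‖ * cv := by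
  intro h₀ h₀' hh₀ hh₀' yN cv hy hcv
  have hcv0 := activityNormLE_nonneg_packageAt P Q hy
  have h1 := hF (hamTuningMap ρ h₀) (hamTuningMap ρ h₀') (inBall_hamTuningMap P hρ hqT₀ h₀)
    (inBall_hamTuningMap P hρ hqT₀ h₀') yN cv hy hcv
  have h2 := esum_hamTuningMap_sub_le P h₀ h₀' hh₀ hh₀'
  calc _ ≤ φT * esum (hamTuningMap ρ h₀ - hamTuningMap ρ h₀') * cv := h1
    _ ≤ φT * (2 * (d : ℝ) ^ 2 / (((P.L ^ (d * 0) : ℕ) : ℝ) * (fieldWt P.h (P.L : ℝ) d 0 / (P.L : ℝ) ^ 0) ^ 2) * ‖h₀ - h₀'‖) * cv := by gcongr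
    _ = _ := by ring

/-- **(F4Φ2) ⟹ `hΦ12`** (LINEARITY of the last-scale functional in the activity): for `r > 0`,
`‖(Φ(h₀,y) − Φ(h₀',y)) − (Φ(h₀,y') − Φ(h₀',y'))‖ = ‖Φ_{q(h₀)}(y − y') − Φ_{q(h₀')}(y − y')‖ ≤ (φ_T c_q)‖h₀ − h₀'‖·c_d`
whenever `‖y − y'‖_N ≤ c_d` (no radius condition on `c_d`). -/
theorem lastScale_sub_sub_le_of_F4Φ2 {φT ρ : ℝ} (hφT : 0 ≤ φT) (hr : 0 < P.r) (hρ : 0 ≤ ρ)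
    (hqT₀ : 2 * (d : ℝ) ^ 2 / (((P.L ^ (d * 0) : ℕ) : ℝ) * (fieldWt P.h (P.L : ℝ) d 0 / (P.L : ℝ) ^ 0) ^ 2) * ρ ≤ P.T₀) (hF : F4Φ2 P Q φT) :
    ∀ h₀ h₀' : HamSpace ℂ d (fieldWt P.h (P.L : ℝ) d 0) ((P.L : ℝ) ^ 0) (P.L ^ (d * 0)), ‖h₀‖ ≤ ρ → ‖h₀'‖ ≤ ρ →
      ∀ (yN yN' : activitySpace Q.normParams N) (cy cy' cd : ℝ),
        activityNormLE Q.normParams N yN cy → cy ≤ P.r → activityNormLE Q.normParams N yN' cy' → cy' ≤ P.r →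
        activityNormLE Q.normParams N (yN - yN') cd →
        ‖(Q.lastScale (hamTuningMap ρ h₀) yN - Q.lastScale (hamTuningMap ρ h₀') yN)
            - (Q.lastScale (hamTuningMap ρ h₀) yN' - Q.lastScale (hamTuningMap ρ h₀') yN')‖ ≤
          φT * (2 * (d : ℝ) ^ 2 / (((P.L ^ (d * 0) : ℕ) : ℝ) * (fieldWt P.h (P.L : ℝ) d 0 / (P.L : ℝ) ^ 0) ^ 2)) * ‖h₀ - h₀'‖ * cd := by
  intro h₀ h₀' hh₀ hh₀' yN yN' cy cy' cd _ _ _ _ hd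
  have hcd0 := activityNormLE_nonneg_packageAt P Q hd
  have hq := inBall_hamTuningMap P hρ hqT₀ h₀
  have hq' := inBall_hamTuningMap P hρ hqT₀ h₀'
  have e : (Q.lastScale (hamTuningMap ρ h₀) yN - Q.lastScale (hamTuningMap ρ h₀') yN)
        - (Q.lastScale (hamTuningMap ρ h₀) yN' - Q.lastScale (hamTuningMap ρ h₀') yN') =
      Q.lastScale (hamTuningMap ρ h₀) (yN - yN') - Q.lastScale (hamTuningMap ρ h₀') (yN - yN') := by
    rw [lastScale_sub P Q hq, lastScale_sub P Q hq']; ring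
  rw [e]
  have h1 := norm_lastScale_sub_le_of_F4Φ2 P Q hr hF hq hq' (yN - yN') hd
  have h2 := esum_hamTuningMap_sub_le P h₀ h₀' hh₀ hh₀'
  calc _ ≤ φT * esum (hamTuningMap ρ h₀ - hamTuningMap ρ h₀') * cd := h1
    _ ≤ φT * (2 * (d : ℝ) ^ 2 / (((P.L ^ (d * 0) : ℕ) : ℝ) * (fieldWt P.h (P.L : ℝ) d 0 / (P.L : ℝ) ^ 0) ^ 2) * ‖h₀ - h₀'‖) * cd := by gcongr
    _ = _ := by ring

/-- **(F4Φ22) ⟹ `hΦ22`**: mixed second differences of `h₀ ↦ Φ(h₀, y)` on parallelograms in the `ρ`-ball. -/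
theorem lastScale_secondDiff_le_of_F4Φ22 {φTT ρ : ℝ} (hφTT : 0 ≤ φTT) (hρ : 0 ≤ ρ)
    (hqT₀ : 2 * (d : ℝ) ^ 2 / (((P.L ^ (d * 0) : ℕ) : ℝ) * (fieldWt P.h (P.L : ℝ) d 0 / (P.L : ℝ) ^ 0) ^ 2) * ρ ≤ P.T₀) (hF : F4Φ22 P Q φTT) :
    ∀ h₀ y z : HamSpace ℂ d (fieldWt P.h (P.L : ℝ) d 0) ((P.L : ℝ) ^ 0) (P.L ^ (d * 0)), ‖h₀‖ ≤ ρ → ‖h₀ + y‖ ≤ ρ → ‖h₀ + z‖ ≤ ρ → ‖h₀ + y + z‖ ≤ ρ →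
      ∀ (yN : activitySpace Q.normParams N) (cv : ℝ), activityNormLE Q.normParams N yN cv → cv ≤ P.r →
        ‖Q.lastScale (hamTuningMap ρ (h₀ + y + z)) yN - Q.lastScale (hamTuningMap ρ (h₀ + y)) yN
            - Q.lastScale (hamTuningMap ρ (h₀ + z)) yN + Q.lastScale (hamTuningMap ρ h₀) yN‖ ≤
          φTT * (2 * (d : ℝ) ^ 2 / (((P.L ^ (d * 0) : ℕ) : ℝ) * (fieldWt P.h (P.L : ℝ) d 0 / (P.L : ℝ) ^ 0) ^ 2)) ^ 2 * ‖y‖ * ‖z‖ * cv := by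
  intro h₀ y z hh₀ hy hz hyz yN cv hv hcv
  have hcv0 := activityNormLE_nonneg_packageAt P Q hv
  have hb0 := inBall_hamTuningMap P hρ hqT₀ h₀
  have hby := inBall_hamTuningMap P hρ hqT₀ (h₀ + y)
  have hbz := inBall_hamTuningMap P hρ hqT₀ (h₀ + z)
  have hbyz := inBall_hamTuningMap P hρ hqT₀ (h₀ + y + z)
  have ey := hamTuningMap_add_eq P hh₀ hy
  have ez := hamTuningMap_add_eq P hh₀ hz
  have eyz := hamTuningMap_add_add_eq P hh₀ hyz
  rw [eyz] at hbyz
  rw [ey] at hby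
  rw [ez] at hbz
  rw [eyz, ey, ez]
  have h1 := hF (hamTuningMap ρ h₀) (hamQuadForm (HamSpace.toHam y)) (hamQuadForm (HamSpace.toHam z))
    hb0 hby hbz hbyz yN cv hv hcv
  have h2 := esum_hamQuadForm_toHam_le P y
  have h3 := esum_hamQuadForm_toHam_le P z
  have h4 := esum_nonneg (hamQuadForm (HamSpace.toHam y))
  have h5 := esum_nonneg (hamQuadForm (HamSpace.toHam z))
  calc _ ≤ φTT * esum (hamQuadForm (HamSpace.toHam y)) * esum (hamQuadForm (HamSpace.toHam z)) * cv := h1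
    _ ≤ φTT * (2 * (d : ℝ) ^ 2 / (((P.L ^ (d * 0) : ℕ) : ℝ) * (fieldWt P.h (P.L : ℝ) d 0 / (P.L : ℝ) ^ 0) ^ 2) * ‖y‖) * (2 * (d : ℝ) ^ 2 / (((P.L ^ (d * 0) : ℕ) : ℝ) * (fieldWt P.h (P.L : ℝ) d 0 / (P.L : ℝ) ^ 0) ^ 2) * ‖z‖) * cv := by gcongr
    _ = _ := by ring

end Summit.HubbardSuperconductivity.HubbardSuperconductivity.Theorems.ComplexGFF

end
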